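import Mathlib
import HarnessLib
import Literature.Probability.LatticeModels.LatticeGreenFunction
import Literature.Probability.LatticeModels.MaxwellKernelBand
import Literature.MathematicalPhysics.QuantumFieldTheory.YangMillsOS

/-!
# Crux `FemtoCurvatureTwoPoint` (stmt-QuantumFields-9363, route `LangevinControlUV`), line
`generic-step-gamma-encoding`: stub `stub_maxwellKernelBand`

K1a — lattice Maxwell kernel band: with `G̃_L = torusGreen` (zero-mode-removed torus Green function,
`ε(p) = Σ(1 - cos pᵢ)` normalisation) and `K_L(z) = ½ Σ_{μ∈{0,1}} (2G̃_L(z) − G̃_L(z+e_μ) − G̃_L(z−e_μ))`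
(`= L⁻⁴ Σ_{k≠0} (k̂₀²+k̂₁²)/k̂² cos(p·z)`, the tree-level `⟨F₀₁(0)F₀₁(z)⟩` kernel),
`c ≤ n⁴ K_L(ne₂) ≤ C` for `1 ≤ n`, `8n ≤ L`, uniformly in `L`.

Proof: `K_L(ne₂)` is the average of the two axis second differences
`2G̃_L(ne₂) - G̃_L(ne₂ ± e_μ)` for `μ = 0, 1`, each of which lies in the band `[c, C]/n⁴` by the
tree's `Literature.Probability.LatticeModels.torusGreen_second_difference_axis_band`
(`MaxwellKernelBand.lean`: transverse reduction to positive cycle resolvents, infrared box for the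
lower bound, factorised exponential sums for the upper bound).
-/

noncomputable section

open scoped BigOperators
open MeasureTheory Filter Topology
open Literature.MathematicalPhysics.QuantumFieldTheory Literature.Probability.LatticeModels

namespace Summit.QuantumFields.YangMills.Theorems.FemtoCurvatureTwoPoint

/-- **Stub `stub_maxwellKernelBand`** of line `generic-step-gamma-encoding` (crux `FemtoCurvatureTwoPoint`, registered signature,
verbatim). -/
theorem stub_maxwellKernelBand :
    ∃ (c C : ℝ), 0 < c ∧ ∀ (L : ℕ) [NeZero L] (e₀ e₁ : Fin 4 → ZMod L) (K : (Fin 4 → ZMod L) → ℝ),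
      e₀ = Pi.single (0 : Fin 4) (1 : ZMod L) → e₁ = Pi.single (1 : Fin 4) (1 : ZMod L) →
      (K = fun z =>
        ((2 * Literature.Probability.LatticeModels.torusGreen z
            - Literature.Probability.LatticeModels.torusGreen (z + e₀)
            - Literature.Probability.LatticeModels.torusGreen (z - e₀))
          + (2 * Literature.Probability.LatticeModels.torusGreen z
            - Literature.Probability.LatticeModels.torusGreen (z + e₁)
            - Literature.Probability.LatticeModels.torusGreen (z - e₁))) / 2) →
      ∀ (n : ℕ), 1 ≤ n → 8 * n ≤ L →
        c ≤ (n : ℝ) ^ 4 * K (Pi.single (2 : Fin 4) ((n : ℕ) : ZMod L)) ∧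
          (n : ℝ) ^ 4 * K (Pi.single (2 : Fin 4) ((n : ℕ) : ZMod L)) ≤ C := by
  obtain ⟨c, C, hc, h⟩ := torusGreen_second_difference_axis_band
  refine ⟨c, C, hc, ?_⟩
  intro L _ e₀ e₁ K he₀ he₁ hK n hn h8
  subst he₀ he₁ hK
  obtain ⟨h0l, h0u⟩ := h L 0 2 (by decide) n hn h8
  obtain ⟨h1l, h1u⟩ := h L 1 2 (by decide) n hn h8
  simp only
  constructor
  · linarith
  · linarith

end Summit.QuantumFields.YangMills.Theorems.FemtoCurvatureTwoPoint

end
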